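import Summits.NavierStokesRegularity.NavierStokesRegularity.Theorems.HodographBetchovFastClassSqueezeMiddleStrainWeyl

/-!
# `FastClassSqueeze` (stmt-NavierStokesRegularity-15832): local Weyl assembly on one germ

Line `Sketch-ideasK1` (idea `resolved-weyl-split`) of crux 3 of route `HodographBetchov`, registered stub
`stub_pointSqueeze_of_subscale` (the LOCAL transfer B1 + B2).  Along a classical solution of unforced
Navier–Stokes on `ℝ³ × [0,T)` that is Leray–Hopf from `u 0`, on a parabolic germ `(τ,T) × B_r(x₀)` with
`τ ≥ 0`, a level `l > 0` and an exponent `q ≥ 3`: if the Miller functional (`2/p + 3/q = 2`) of the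
SUBSCALE middle principal strain `λ₂(∇u − A_R)⁺` of the fast fluid `{l < |u|}` is finite, so is that of
the FULL middle strain `λ₂(∇u)⁺`; here `A_R(t,x) = ⨍_{B̄_R(x)} ∇u(t)` is the closed-ball average and
`λ₂(A) = strainEigenvalues A _ 1` (the tree's `Literature.Analysis.FluidPDE.strainEigenvalues`, clipped at
`0` by `ENNReal.ofReal`).

* pointwise Weyl `λ₂(∇u) ≤ λ₂(∇u − A_R) + ‖A_R‖` (`GermWeyl.middleStrain_le_middleStrain_sub_add_opNorm`),
  monotonicity and subadditivity of `ENNReal.ofReal`, and `(a + b)^q ≤ 2^{q−1}(a^q + b^q)`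
  (`ofReal_middleStrain_rpow_le`);
* the inner integral over `{l < |u(t)|} ∩ B_r(x₀)` splits because the resolved summand
  `x ↦ (ofReal ‖A_R(t,x)‖)^q` is continuous (`WeylSplit.continuous_setAverage_closedBall`); the resolved
  local integral is at most the global one, which B2 (`WeylSplit.resolved_rpow_le`) bounds pointwise in
  time by `K(1 + ∫|∇u(t)|²_F)`;
* `2/(2q−3) ≤ 1` makes the outer power subadditive; in time `(τ,T) ⊆ (0,T)` (this is where `τ ≥ 0` is
  used), the outer integral splits along the measurable-in-time extension of the dissipation slice
  (`WeylSplit.exists_measurable_dissipation_slice`), and `∫₀ᵀ∫|∇u|²_F < ∞`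
  (`IsLerayHopfOn.lintegral_frobeniusNormSq_fderiv_of_classical`).

The proof is the germ-localised copy of `WeylSplit.fastClassSqueeze_of_subscaleSqueeze`
(`HodographBetchovFastClassSqueezeWeylSplitTransfer.lean`).
-/

noncomputable section

-- the summit and its single problem share the name `NavierStokesRegularity` (D-0017 nested layout)
set_option linter.dupNamespace false

namespace Summit.NavierStokesRegularity.NavierStokesRegularity.Theorems.FastClassSqueeze.GermWeyl

open Set MeasureTheory Filter Topology Metric Literature.Analysis.FluidPDE
open scoped ENNReal NNReal

/-- **Pointwise Weyl for the clipped middle principal strain, raised to a power `q ≥ 1`:**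
`(λ₂(A)⁺)^q ≤ 2^{q−1} ((λ₂(A − B)⁺)^q + ‖B‖^q)` in `ℝ≥0∞` (`λ₂(A) ≤ λ₂(A − B) + ‖B‖`, `ofReal` is
monotone and subadditive, and `(a + b)^q ≤ 2^{q−1}(a^q + b^q)`). [cite: HornJohnson2013, Thm 4.3.1] -/
theorem ofReal_middleStrain_rpow_le
    (A B : EuclideanSpace ℝ (Fin 3) →L[ℝ] EuclideanSpace ℝ (Fin 3)) {q : ℝ} (hq : 1 ≤ q) :
    ENNReal.ofReal (strainEigenvalues
        ((A : EuclideanSpace ℝ (Fin 3) →L[ℝ] EuclideanSpace ℝ (Fin 3)) :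
          EuclideanSpace ℝ (Fin 3) →ₗ[ℝ] EuclideanSpace ℝ (Fin 3)) finrank_euclideanSpace_fin 1) ^ q ≤
      (2 : ℝ≥0∞) ^ (q - 1) *
        (ENNReal.ofReal (strainEigenvalues
            ((A - B : EuclideanSpace ℝ (Fin 3) →L[ℝ] EuclideanSpace ℝ (Fin 3)) :
              EuclideanSpace ℝ (Fin 3) →ₗ[ℝ] EuclideanSpace ℝ (Fin 3)) finrank_euclideanSpace_fin 1) ^ q +
          ENNReal.ofReal ‖B‖ ^ q) := by
  have h1 : ENNReal.ofReal (strainEigenvalues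
        ((A : EuclideanSpace ℝ (Fin 3) →L[ℝ] EuclideanSpace ℝ (Fin 3)) :
          EuclideanSpace ℝ (Fin 3) →ₗ[ℝ] EuclideanSpace ℝ (Fin 3)) finrank_euclideanSpace_fin 1) ≤
      ENNReal.ofReal (strainEigenvalues
          ((A - B : EuclideanSpace ℝ (Fin 3) →L[ℝ] EuclideanSpace ℝ (Fin 3)) :
            EuclideanSpace ℝ (Fin 3) →ₗ[ℝ] EuclideanSpace ℝ (Fin 3)) finrank_euclideanSpace_fin 1) +
        ENNReal.ofReal ‖B‖ :=
    (ENNReal.ofReal_le_ofReal (middleStrain_le_middleStrain_sub_add_opNorm A B)).trans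
      ENNReal.ofReal_add_le
  exact (ENNReal.rpow_le_rpow h1 (by linarith)).trans (ENNReal.rpow_add_le_mul_rpow_add_rpow _ _ hq)

/-- **Stub 2 of line `Sketch-ideasK1` — local Weyl assembly on one germ (B1 + B2 restricted to a ball).**
For a classical solution of unforced Navier–Stokes on `ℝ³ × [0,T)` that is Leray–Hopf from `u 0`, a centre
`x₀`, radius `r`, resolution `R`, time `τ ≥ 0`, level `l > 0` and exponent `q ≥ 3`: if the subscale middle
strain `λ₂(∇u − ⨍_{B̄_R(x)} ∇u(t))⁺` of the fast fluid `{l < |u(t)|}` has a finite Miller functional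
`∫_τ^T (∫_{{l<|u(t)|} ∩ B_r(x₀)} (λ₂⁺)^q dx)^{2/(2q−3)} dt` on the germ, so has the full middle strain
`λ₂(∇u)⁺` (`λ₂(∇u) ≤ λ₂(∇u − A_R) + ‖A_R‖`, `(a+b)^q ≤ 2^{q−1}(a^q+b^q)`, `(X+Y)^{2/(2q−3)} ≤ X^{2/(2q−3)} +
Y^{2/(2q−3)}`, and the resolved gradient is a-priori Miller-finite for `q ≥ 3`, `WeylSplit.resolved_rpow_le`,
with `∫₀ᵀ∫|∇u|²_F < ∞`). [cite: Constantin1990, §2 eq. (2.21)] -/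
theorem stub_pointSqueeze_of_subscale :
    ∀ (ν T : ℝ), 0 < ν → 0 < T →
      ∀ (u : ℝ → EuclideanSpace ℝ (Fin 3) → EuclideanSpace ℝ (Fin 3)) (p : ℝ → EuclideanSpace ℝ (Fin 3) → ℝ),
      Literature.Analysis.FluidPDE.IsClassicalNSSolutionOn (Set.Ico 0 T) ν 0 u p →
      Literature.Analysis.FluidPDE.IsLerayHopfOn T ν 0 (u 0) u →
      ∀ (x₀ : EuclideanSpace ℝ (Fin 3)) (r R τ l q : ℝ), 0 ≤ τ → 0 < l → 3 ≤ q →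
        ∫⁻ t in Set.Ioo τ T, (∫⁻ x in {x : EuclideanSpace ℝ (Fin 3) | l < ‖u t x‖} ∩ Metric.ball x₀ r,
            ENNReal.ofReal (Literature.Analysis.FluidPDE.strainEigenvalues
              ((fderiv ℝ (u t) x - ⨍ y in Metric.closedBall x R, fderiv ℝ (u t) y :
                  EuclideanSpace ℝ (Fin 3) →L[ℝ] EuclideanSpace ℝ (Fin 3)) :
                EuclideanSpace ℝ (Fin 3) →ₗ[ℝ] EuclideanSpace ℝ (Fin 3))
              finrank_euclideanSpace_fin 1) ^ q) ^ (2 / (2 * q - 3)) < ⊤ →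
        ∫⁻ t in Set.Ioo τ T, (∫⁻ x in {x : EuclideanSpace ℝ (Fin 3) | l < ‖u t x‖} ∩ Metric.ball x₀ r,
            ENNReal.ofReal (Literature.Analysis.FluidPDE.strainEigenvalues
              ((fderiv ℝ (u t) x : EuclideanSpace ℝ (Fin 3) →L[ℝ] EuclideanSpace ℝ (Fin 3)) :
                EuclideanSpace ℝ (Fin 3) →ₗ[ℝ] EuclideanSpace ℝ (Fin 3))
              finrank_euclideanSpace_fin 1) ^ q) ^ (2 / (2 * q - 3)) < ⊤ := by
  intro ν T hν hT u p hcl hLH x₀ r R τ l q hτ0 hl hq hint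
  -- ### the a-priori data: B2, the dissipation bound, the measurable dissipation slice
  obtain ⟨K, hKtop, hK⟩ := WeylSplit.resolved_rpow_le hν.le hcl hLH R hl hq
  obtain ⟨hGfin, -⟩ := hLH.lintegral_frobeniusNormSq_fderiv_of_classical hcl hT
  obtain ⟨Gm, hGm, hGm_eq⟩ := WeylSplit.exists_measurable_dissipation_slice hcl
  -- notation: the resolved gradient and the outer exponent
  set A : ℝ → EuclideanSpace ℝ (Fin 3) → (EuclideanSpace ℝ (Fin 3) →L[ℝ] EuclideanSpace ℝ (Fin 3)) :=
    fun t x => ⨍ y in closedBall x R, fderiv ℝ (u t) y with hA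
  have hq1 : 1 ≤ q := by linarith
  set e : ℝ := 2 / (2 * q - 3) with he
  have h2q3 : 0 < 2 * q - 3 := by linarith
  have he0 : 0 ≤ e := by rw [he]; exact div_nonneg zero_le_two h2q3.le
  have he1 : e ≤ 1 := by rw [he, div_le_one h2q3]; linarith
  set C₂ : ℝ≥0∞ := ((2 : ℝ≥0∞) ^ (q - 1)) ^ e with hC₂
  have hC₂top : C₂ ≠ ⊤ :=
    ENNReal.rpow_ne_top_of_nonneg he0 (ENNReal.rpow_ne_top_of_nonneg (by linarith) ENNReal.ofNat_ne_top)
  -- ### pointwise in time: `(∫_S (λ₂⁺)^q)^e ≤ C₂ ((∫_S (λ₂,sub⁺)^q)^e + K (1 + Gm t))`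
  have hpt : ∀ t ∈ Ioo 0 T,
      (∫⁻ x in {x : EuclideanSpace ℝ (Fin 3) | l < ‖u t x‖} ∩ ball x₀ r,
          ENNReal.ofReal (strainEigenvalues
            ((fderiv ℝ (u t) x : EuclideanSpace ℝ (Fin 3) →L[ℝ] EuclideanSpace ℝ (Fin 3)) :
              EuclideanSpace ℝ (Fin 3) →ₗ[ℝ] EuclideanSpace ℝ (Fin 3))
            finrank_euclideanSpace_fin 1) ^ q) ^ e ≤
        C₂ * ((∫⁻ x in {x : EuclideanSpace ℝ (Fin 3) | l < ‖u t x‖} ∩ ball x₀ r,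
          ENNReal.ofReal (strainEigenvalues
            ((fderiv ℝ (u t) x - A t x : EuclideanSpace ℝ (Fin 3) →L[ℝ] EuclideanSpace ℝ (Fin 3)) :
              EuclideanSpace ℝ (Fin 3) →ₗ[ℝ] EuclideanSpace ℝ (Fin 3))
            finrank_euclideanSpace_fin 1) ^ q) ^ e + K * (1 + Gm t)) := by
    intro t ht
    have ht' : t ∈ Ico 0 T := Ioo_subset_Ico_self ht
    set S : Set (EuclideanSpace ℝ (Fin 3)) := {x | l < ‖u t x‖} ∩ ball x₀ r with hS
    -- measurability of the resolved integrand in `x`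
    have hsmooth : ContDiff ℝ 1 (u t) := (hcl.contDiff_velocity ht').of_le (by norm_cast)
    have hAcont : Continuous (A t) := by
      rw [hA]
      exact WeylSplit.continuous_setAverage_closedBall (hsmooth.continuous_fderiv one_ne_zero) R
    have hAmeas : AEMeasurable (fun x => ENNReal.ofReal ‖A t x‖ ^ q) (volume.restrict S) :=
      ((hAcont.norm.measurable.ennreal_ofReal).pow_const q).aemeasurable
    -- split the inner integral (pointwise Weyl + convexity, then additivity along the measurable summand)
    have hinner : (∫⁻ x in S, ENNReal.ofReal (strainEigenvalues
          ((fderiv ℝ (u t) x : EuclideanSpace ℝ (Fin 3) →L[ℝ] EuclideanSpace ℝ (Fin 3)) :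
            EuclideanSpace ℝ (Fin 3) →ₗ[ℝ] EuclideanSpace ℝ (Fin 3)) finrank_euclideanSpace_fin 1) ^ q) ≤
        (2 : ℝ≥0∞) ^ (q - 1) * ((∫⁻ x in S, ENNReal.ofReal (strainEigenvalues
          ((fderiv ℝ (u t) x - A t x : EuclideanSpace ℝ (Fin 3) →L[ℝ] EuclideanSpace ℝ (Fin 3)) :
            EuclideanSpace ℝ (Fin 3) →ₗ[ℝ] EuclideanSpace ℝ (Fin 3)) finrank_euclideanSpace_fin 1) ^ q) +
          ∫⁻ x in S, ENNReal.ofReal ‖A t x‖ ^ q) := by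
      calc (∫⁻ x in S, ENNReal.ofReal (strainEigenvalues
            ((fderiv ℝ (u t) x : EuclideanSpace ℝ (Fin 3) →L[ℝ] EuclideanSpace ℝ (Fin 3)) :
              EuclideanSpace ℝ (Fin 3) →ₗ[ℝ] EuclideanSpace ℝ (Fin 3)) finrank_euclideanSpace_fin 1) ^ q)
          ≤ ∫⁻ x in S, (2 : ℝ≥0∞) ^ (q - 1) * (ENNReal.ofReal (strainEigenvalues
              ((fderiv ℝ (u t) x - A t x : EuclideanSpace ℝ (Fin 3) →L[ℝ] EuclideanSpace ℝ (Fin 3)) :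
                EuclideanSpace ℝ (Fin 3) →ₗ[ℝ] EuclideanSpace ℝ (Fin 3)) finrank_euclideanSpace_fin 1) ^ q +
              ENNReal.ofReal ‖A t x‖ ^ q) :=
            lintegral_mono fun x => ofReal_middleStrain_rpow_le _ _ hq1
        _ = (2 : ℝ≥0∞) ^ (q - 1) * ((∫⁻ x in S, ENNReal.ofReal (strainEigenvalues
              ((fderiv ℝ (u t) x - A t x : EuclideanSpace ℝ (Fin 3) →L[ℝ] EuclideanSpace ℝ (Fin 3)) :
                EuclideanSpace ℝ (Fin 3) →ₗ[ℝ] EuclideanSpace ℝ (Fin 3)) finrank_euclideanSpace_fin 1) ^ q) +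
              ∫⁻ x in S, ENNReal.ofReal ‖A t x‖ ^ q) := by
            rw [lintegral_const_mul' _ _ (ENNReal.rpow_ne_top_of_nonneg (by linarith)
              ENNReal.ofNat_ne_top), lintegral_add_right' _ hAmeas]
    -- the resolved half: local `≤` global, raised to the power `e`, bounded by B2
    have hres : (∫⁻ x in S, ENNReal.ofReal ‖A t x‖ ^ q) ^ e ≤ K * (1 + Gm t) := by
      calc (∫⁻ x in S, ENNReal.ofReal ‖A t x‖ ^ q) ^ e
          ≤ (∫⁻ x in {x : EuclideanSpace ℝ (Fin 3) | l < ‖u t x‖}, ENNReal.ofReal ‖A t x‖ ^ q) ^ e :=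
            ENNReal.rpow_le_rpow (lintegral_mono_set inter_subset_left) he0
        _ ≤ K * (1 + ∫⁻ y, ENNReal.ofReal (frobeniusNormSq (fderiv ℝ (u t) y))) := hK t ht'
        _ = K * (1 + Gm t) := by rw [hGm_eq t ht]
    calc (∫⁻ x in S, ENNReal.ofReal (strainEigenvalues
          ((fderiv ℝ (u t) x : EuclideanSpace ℝ (Fin 3) →L[ℝ] EuclideanSpace ℝ (Fin 3)) :
            EuclideanSpace ℝ (Fin 3) →ₗ[ℝ] EuclideanSpace ℝ (Fin 3)) finrank_euclideanSpace_fin 1) ^ q) ^ e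
        ≤ ((2 : ℝ≥0∞) ^ (q - 1) * ((∫⁻ x in S, ENNReal.ofReal (strainEigenvalues
            ((fderiv ℝ (u t) x - A t x : EuclideanSpace ℝ (Fin 3) →L[ℝ] EuclideanSpace ℝ (Fin 3)) :
              EuclideanSpace ℝ (Fin 3) →ₗ[ℝ] EuclideanSpace ℝ (Fin 3)) finrank_euclideanSpace_fin 1) ^ q) +
            ∫⁻ x in S, ENNReal.ofReal ‖A t x‖ ^ q)) ^ e := ENNReal.rpow_le_rpow hinner he0
      _ = C₂ * ((∫⁻ x in S, ENNReal.ofReal (strainEigenvalues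
            ((fderiv ℝ (u t) x - A t x : EuclideanSpace ℝ (Fin 3) →L[ℝ] EuclideanSpace ℝ (Fin 3)) :
              EuclideanSpace ℝ (Fin 3) →ₗ[ℝ] EuclideanSpace ℝ (Fin 3)) finrank_euclideanSpace_fin 1) ^ q) +
            ∫⁻ x in S, ENNReal.ofReal ‖A t x‖ ^ q) ^ e := by
          rw [ENNReal.mul_rpow_of_nonneg _ _ he0, hC₂]
      _ ≤ C₂ * ((∫⁻ x in S, ENNReal.ofReal (strainEigenvalues
            ((fderiv ℝ (u t) x - A t x : EuclideanSpace ℝ (Fin 3) →L[ℝ] EuclideanSpace ℝ (Fin 3)) :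
              EuclideanSpace ℝ (Fin 3) →ₗ[ℝ] EuclideanSpace ℝ (Fin 3)) finrank_euclideanSpace_fin 1) ^ q) ^ e +
            (∫⁻ x in S, ENNReal.ofReal ‖A t x‖ ^ q) ^ e) :=
          mul_le_mul_right (ENNReal.rpow_add_le_add_rpow _ _ he0 he1) _
      _ ≤ C₂ * ((∫⁻ x in S, ENNReal.ofReal (strainEigenvalues
            ((fderiv ℝ (u t) x - A t x : EuclideanSpace ℝ (Fin 3) →L[ℝ] EuclideanSpace ℝ (Fin 3)) :
              EuclideanSpace ℝ (Fin 3) →ₗ[ℝ] EuclideanSpace ℝ (Fin 3)) finrank_euclideanSpace_fin 1) ^ q) ^ e +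
            K * (1 + Gm t)) :=
          mul_le_mul_right (add_le_add le_rfl hres) _
  -- ### integrate in time over `(τ,T) ⊆ (0,T)` (here `0 ≤ τ` is used)
  have hmaj : AEMeasurable (fun t => K * (1 + Gm t)) (volume.restrict (Ioo τ T)) :=
    ((hGm.const_add 1).const_mul K).aemeasurable
  have hle : ∫⁻ t in Ioo τ T, (∫⁻ x in {x : EuclideanSpace ℝ (Fin 3) | l < ‖u t x‖} ∩ ball x₀ r,
        ENNReal.ofReal (strainEigenvalues
          ((fderiv ℝ (u t) x : EuclideanSpace ℝ (Fin 3) →L[ℝ] EuclideanSpace ℝ (Fin 3)) :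
            EuclideanSpace ℝ (Fin 3) →ₗ[ℝ] EuclideanSpace ℝ (Fin 3))
          finrank_euclideanSpace_fin 1) ^ q) ^ e ≤
      ∫⁻ t in Ioo τ T, C₂ * ((∫⁻ x in {x : EuclideanSpace ℝ (Fin 3) | l < ‖u t x‖} ∩ ball x₀ r,
        ENNReal.ofReal (strainEigenvalues
          ((fderiv ℝ (u t) x - A t x : EuclideanSpace ℝ (Fin 3) →L[ℝ] EuclideanSpace ℝ (Fin 3)) :
            EuclideanSpace ℝ (Fin 3) →ₗ[ℝ] EuclideanSpace ℝ (Fin 3))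
          finrank_euclideanSpace_fin 1) ^ q) ^ e + K * (1 + Gm t)) := by
    refine lintegral_mono_ae ?_
    filter_upwards [ae_restrict_mem measurableSet_Ioo] with t ht
    exact hpt t ⟨hτ0.trans_lt ht.1, ht.2⟩
  refine lt_of_le_of_lt hle ?_
  rw [lintegral_const_mul' _ _ hC₂top, lintegral_add_right' _ hmaj]
  refine ENNReal.mul_lt_top hC₂top.lt_top (ENNReal.add_lt_top.2 ⟨hint, ?_⟩)
  -- the resolved majorant is integrable on `(0,T) ⊇ (τ,T)`: `K (T + ∫₀ᵀ∫ |∇u|²_F) < ∞`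
  have hGm_int : ∫⁻ t in Ioo 0 T, Gm t =
      ∫⁻ t in Ioo 0 T, ∫⁻ y, ENNReal.ofReal (frobeniusNormSq (fderiv ℝ (u t) y)) :=
    setLIntegral_congr_fun measurableSet_Ioo hGm_eq
  calc ∫⁻ t in Ioo τ T, K * (1 + Gm t)
      ≤ ∫⁻ t in Ioo 0 T, K * (1 + Gm t) := lintegral_mono_set (Ioo_subset_Ioo_left hτ0)
    _ < ⊤ := by
        rw [lintegral_const_mul' _ _ hKtop, lintegral_add_left measurable_const, lintegral_const,
          Measure.restrict_apply_univ, Real.volume_Ioo, hGm_int]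
        refine ENNReal.mul_lt_top hKtop.lt_top ?_
        exact ENNReal.add_lt_top.2 ⟨by rw [one_mul]; exact ENNReal.ofReal_lt_top, hGfin.lt_top⟩

end Summit.NavierStokesRegularity.NavierStokesRegularity.Theorems.FastClassSqueeze.GermWeyl

end
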